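import Mathlib
import Summits.Ventures.HodgeRepro2.T5AdicCompletionSummary
import Summits.Ventures.HodgeRepro2.T5RamifiedUnitFiltration
import Summits.Ventures.HodgeRepro2.T5RamifiedCharacterInflation

/-!
# The ramified quadratic place on Mathlib's number-field completions

`T5AdicCompletionInert` instantiates the (A10)-type statements of `route/TIER5.md` at a
quadratic INERT place of Mathlib's concrete completions `Kv := v.adicCompletion K ⊆
Lw := w.adicCompletion L` («`ϖ_F` stays a uniformiser of `E_v`»). This file is the RAMIFIED
complement — Lemma N5.L4(iv-a)/(iv-b) of §N5.11.4 on the same concrete pair, under the single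
hypothesis «`[Lw : Kv] = 2` and `ϖ_F` does NOT stay a uniformiser» (`¬ Irreducible (algebraMap ϖ)`):

* `ramificationIdx'_eq_two_of_not_irreducible` / `inertiaDeg'_eq_one_of_not_irreducible`:
  `e = 2`, `f = 1` (from `e · f = [Lw : Kv]` of `T5AdicCompletionIntegral` and the uniformiser
  relation `algebraMap ϖ = u · π ^ e` of `T5ContinuousValuationExtension`);
* `exists_unit_algebraMap_eq_mul_sq`: `algebraMap ϖ = u · π²` — the hypothesis of
  `T5RamifiedUnitFiltration`;
* `exists_dvd_sub_algebraMap_of_inertiaDeg'_eq_one`: residue degree one means every element of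
  `O_{E_v}` is congruent modulo `π` to an element of `O_{F_v}` (the hypothesis `hres` of
  `T5RamifiedUnitFiltration`), from Mathlib's `inertiaDeg'_algebraMap` and
  `Subalgebra.bot_eq_top_of_finrank_eq_one`;
* `exists_character_exact_even_level_of_quadratic_ramified` («conjugate-orthogonal characters of
  every EVEN exact conductor exist at a ramified place», unit-group level),
  `exists_character_trivial_on_exact_even_level_of_quadratic_ramified` (the same at the level of
  `Lwˣ`, trivial on any subgroup `F` with `F ∩ O_{Lw}ˣ ⊆ image(O_{Kv}ˣ)`), and
  `eq_one_of_mem_higherUnits_two_mul_of_quadratic_ramified` («no conjugate-orthogonal character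
  of ODD conductor at a ramified place»).

Together with `T5AdicCompletionInert.exists_character_exact_level_of_quadratic_inert` the two
cases of a quadratic extension of local fields (`ϖ_F` irreducible in `O_{E_v}` or not) are both
covered. Stays prose: the identification of the datum's `(F_v, E_v, F_v^×)` with
`(Kv, Lw, F)` — an instantiation, not a theorem.
Declaration per README §8(d): «uses an L-value-free non-vanishing device: NO».
-/

namespace Summit.Ventures.HodgeRepro2.T5AdicCompletionRamified

open T5PrincipalUnitFiltration T5PrincipalUnitComparison IsDedekindDomain HeightOneSpectrum

section Abstract

variable {A B : Type*} [CommRing A] [CommRing B] [Algebra A B]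

/-- If `P` lies over the maximal ideal `p` with residue degree one
(`p.inertiaDeg' P = 1`), every element of `B` is congruent modulo `P` to an element of `A`:
the residue field extension `(A ⧸ p) → (B ⧸ P)` has degree one, so `⊥ = ⊤`. -/
theorem exists_sub_algebraMap_mem_of_inertiaDeg'_eq_one (p : Ideal A) (P : Ideal B)
    [p.IsMaximal] [P.LiesOver p] (hf : p.inertiaDeg' P = 1) (s : B) :
    ∃ a : A, s - algebraMap A B a ∈ P := by
  letI : Field (A ⧸ p) := Ideal.Quotient.field p
  haveI : Nontrivial (B ⧸ P) := Ideal.Quotient.nontrivial_of_liesOver_of_isPrime P p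
  rw [Ideal.inertiaDeg'_algebraMap] at hf
  have htop := Subalgebra.bot_eq_top_of_finrank_eq_one hf
  have hmem : Ideal.Quotient.mk P s ∈ (⊥ : Subalgebra (A ⧸ p) (B ⧸ P)) := by
    rw [htop]; exact Algebra.mem_top
  obtain ⟨a', ha'⟩ := Algebra.mem_bot.1 hmem
  obtain ⟨a, rfl⟩ := Ideal.Quotient.mk_surjective a'
  refine ⟨a, ?_⟩
  rw [Ideal.Quotient.algebraMap_mk_of_liesOver] at ha'
  exact Ideal.Quotient.eq.1 ha'.symm

variable [IsDomain A] [IsDiscreteValuationRing A] [IsDomain B] [IsDiscreteValuationRing B]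

/-- For discrete valuation rings `A → B` with uniformisers `ϖ`, `π` and `π ∣ algebraMap ϖ`, the
prime `(π)` lies over `(ϖ)` (the contraction of `(π)` is a proper ideal containing `ϖ`, hence
equals the maximal ideal `(ϖ)`). -/
theorem liesOver_span_of_dvd {ϖ : A} {π : B} (hϖ : Irreducible ϖ) (hπ : Irreducible π)
    (h : π ∣ algebraMap A B ϖ) : (Ideal.span {π}).LiesOver (Ideal.span {ϖ}) := by
  refine ⟨(T5AdicCompletionInert.span_isMaximal hϖ).eq_of_le
    (Ideal.comap_ne_top _ (T5AdicCompletionInert.span_isMaximal hπ).ne_top) ?_⟩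
  rw [Ideal.span_le, Set.singleton_subset_iff]
  exact Ideal.mem_comap.2 (Ideal.mem_span_singleton.2 h)

/-- Residue degree one for a pair of discrete valuation rings with `π ∣ algebraMap ϖ`: every
`s ∈ B` is congruent modulo `π` to an element of `A` — the hypothesis `hres` of
`T5RamifiedUnitFiltration`. -/
theorem exists_dvd_sub_algebraMap_of_inertiaDeg'_eq_one {ϖ : A} {π : B} (hϖ : Irreducible ϖ)
    (hπ : Irreducible π) (h : π ∣ algebraMap A B ϖ)
    (hf : (Ideal.span {ϖ}).inertiaDeg' (Ideal.span {π}) = 1) (s : B) :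
    ∃ a : A, π ∣ s - algebraMap A B a := by
  haveI := T5AdicCompletionInert.span_isMaximal hϖ
  haveI := liesOver_span_of_dvd hϖ hπ h
  obtain ⟨a, ha⟩ := exists_sub_algebraMap_mem_of_inertiaDeg'_eq_one (Ideal.span {ϖ})
    (Ideal.span {π}) hf s
  exact ⟨a, Ideal.mem_span_singleton.1 ha⟩

end Abstract

section Concrete

variable {K : Type*} [Field K] [NumberField K] (v : HeightOneSpectrum (NumberField.RingOfIntegers K))
variable {L : Type*} [Field L] [NumberField L] [Algebra K L]
  (w : HeightOneSpectrum (NumberField.RingOfIntegers L))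
variable [Algebra (adicCompletion K v) (adicCompletion L w)]
  [ContinuousSMul (adicCompletion K v) (adicCompletion L w)]
  [IsScalarTower K (adicCompletion K v) (adicCompletion L w)]


/-- `e · f = 2` at a quadratic place. -/
theorem ramificationIdx'_mul_inertiaDeg'_eq_two
    (hfin : Module.finrank (adicCompletion K v) (adicCompletion L w) = 2)
    {ϖ : (adicCompletionIntegers K v)} (hϖ : Irreducible ϖ) {π : (adicCompletionIntegers L w)} (hπ : Irreducible π) :
    (Ideal.span {ϖ}).ramificationIdx' (Ideal.span {π}) *
      (Ideal.span {ϖ}).inertiaDeg' (Ideal.span {π}) = 2 := by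
  rw [T5AdicCompletionIntegral.ramificationIdx'_mul_inertiaDeg'_eq_finrank v w ϖ hϖ π hπ, hfin]

/-- At a quadratic place where `ϖ_F` does not stay a uniformiser, `e = 2`: `e · f = 2` forces
`e ∈ {1, 2}`, and `e = 1` would make `algebraMap ϖ = u · π` irreducible. -/
theorem ramificationIdx'_eq_two_of_not_irreducible
    (hfin : Module.finrank (adicCompletion K v) (adicCompletion L w) = 2)
    {ϖ : (adicCompletionIntegers K v)} (hϖ : Irreducible ϖ) {π : (adicCompletionIntegers L w)} (hπ : Irreducible π)
    (hram : ¬ Irreducible (algebraMap (adicCompletionIntegers K v) (adicCompletionIntegers L w) ϖ)) :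
    (Ideal.span {ϖ}).ramificationIdx' (Ideal.span {π}) = 2 := by
  have hef := ramificationIdx'_mul_inertiaDeg'_eq_two v w hfin hϖ hπ
  obtain ⟨u, hu⟩ := T5ContinuousValuationExtension.exists_unit_algebraMap_eq_mul_pow
    (v := v) (w := w) ϖ hϖ.ne_zero π hπ
  set e := (Ideal.span {ϖ}).ramificationIdx' (Ideal.span {π}) with he
  have he_dvd : e ∣ 2 := Dvd.intro _ hef
  have he_le : e ≤ 2 := Nat.le_of_dvd two_pos he_dvd
  have he_ne : e ≠ 0 := by
    intro h0
    rw [h0, zero_mul] at hef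
    exact absurd hef (by norm_num)
  have he_ne_one : e ≠ 1 := by
    intro h1
    apply hram
    rw [hu, h1, pow_one]
    exact (irreducible_isUnit_mul u.isUnit).2 hπ
  omega

omit [Algebra K L] [IsScalarTower K (adicCompletion K v) (adicCompletion L w)] in
/-- The converse: if `e = 1` then `algebraMap ϖ = u · π` is irreducible («`ϖ_F` stays a
uniformiser»). -/
theorem irreducible_of_ramificationIdx'_eq_one
    {ϖ : (adicCompletionIntegers K v)} (hϖ : Irreducible ϖ) {π : (adicCompletionIntegers L w)} (hπ : Irreducible π)
    (he : (Ideal.span {ϖ}).ramificationIdx' (Ideal.span {π}) = 1) :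
    Irreducible (algebraMap (adicCompletionIntegers K v) (adicCompletionIntegers L w) ϖ) := by
  obtain ⟨u, hu⟩ := T5ContinuousValuationExtension.exists_unit_algebraMap_eq_mul_pow
    (v := v) (w := w) ϖ hϖ.ne_zero π hπ
  rw [hu, he, pow_one]
  exact (irreducible_isUnit_mul u.isUnit).2 hπ

/-- THE DICHOTOMY at a quadratic place: `ϖ_F` stays a uniformiser of `O_{Lw}` (the INERT case of
`T5AdicCompletionInert`, `e = 1`) or not (the RAMIFIED case of this file, `e = 2`) — exactly
one of the two, and `e ∈ {1, 2}`. -/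
theorem ramificationIdx'_eq_one_iff_irreducible
    (hfin : Module.finrank (adicCompletion K v) (adicCompletion L w) = 2)
    {ϖ : (adicCompletionIntegers K v)} (hϖ : Irreducible ϖ) {π : (adicCompletionIntegers L w)} (hπ : Irreducible π) :
    (Ideal.span {ϖ}).ramificationIdx' (Ideal.span {π}) = 1 ↔
      Irreducible (algebraMap (adicCompletionIntegers K v) (adicCompletionIntegers L w) ϖ) := by
  refine ⟨irreducible_of_ramificationIdx'_eq_one v w hϖ hπ, fun h => ?_⟩
  have hef := ramificationIdx'_mul_inertiaDeg'_eq_two v w hfin hϖ hπ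
  by_contra hne
  have h2 : (Ideal.span {ϖ}).ramificationIdx' (Ideal.span {π}) = 2 := by
    have hdvd : (Ideal.span {ϖ}).ramificationIdx' (Ideal.span {π}) ∣ 2 := Dvd.intro _ hef
    have hle := Nat.le_of_dvd two_pos hdvd
    have hne0 : (Ideal.span {ϖ}).ramificationIdx' (Ideal.span {π}) ≠ 0 := by
      intro h0
      rw [h0, zero_mul] at hef
      exact absurd hef (by norm_num)
    omega
  obtain ⟨u, hu⟩ := T5ContinuousValuationExtension.exists_unit_algebraMap_eq_mul_pow
    (v := v) (w := w) ϖ hϖ.ne_zero π hπ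
  rw [hu, h2] at h
  have h' : Irreducible (π * π) := by rwa [← pow_two, ← irreducible_isUnit_mul u.isUnit]
  exact hπ.not_isUnit ((h'.isUnit_or_isUnit rfl).elim id id)

/-- At a quadratic place where `ϖ_F` does not stay a uniformiser, `algebraMap ϖ = u · π²`
(the hypothesis of `T5RamifiedUnitFiltration`). -/
theorem exists_unit_algebraMap_eq_mul_sq
    (hfin : Module.finrank (adicCompletion K v) (adicCompletion L w) = 2)
    {ϖ : (adicCompletionIntegers K v)} (hϖ : Irreducible ϖ) {π : (adicCompletionIntegers L w)} (hπ : Irreducible π)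
    (hram : ¬ Irreducible (algebraMap (adicCompletionIntegers K v) (adicCompletionIntegers L w) ϖ)) :
    ∃ u : (adicCompletionIntegers L w)ˣ, algebraMap (adicCompletionIntegers K v) (adicCompletionIntegers L w) ϖ = u * π ^ 2 := by
  obtain ⟨u, hu⟩ := T5ContinuousValuationExtension.exists_unit_algebraMap_eq_mul_pow
    (v := v) (w := w) ϖ hϖ.ne_zero π hπ
  rw [ramificationIdx'_eq_two_of_not_irreducible v w hfin hϖ hπ hram] at hu
  exact ⟨u, hu⟩

/-- At a quadratic place where `ϖ_F` does not stay a uniformiser, `f = 1`. -/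
theorem inertiaDeg'_eq_one_of_not_irreducible
    (hfin : Module.finrank (adicCompletion K v) (adicCompletion L w) = 2)
    {ϖ : (adicCompletionIntegers K v)} (hϖ : Irreducible ϖ) {π : (adicCompletionIntegers L w)} (hπ : Irreducible π)
    (hram : ¬ Irreducible (algebraMap (adicCompletionIntegers K v) (adicCompletionIntegers L w) ϖ)) :
    (Ideal.span {ϖ}).inertiaDeg' (Ideal.span {π}) = 1 := by
  have hef := ramificationIdx'_mul_inertiaDeg'_eq_two v w hfin hϖ hπ
  rw [ramificationIdx'_eq_two_of_not_irreducible v w hfin hϖ hπ hram] at hef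
  omega

/-- At a ramified quadratic place every element of `O_{E_v}` is congruent modulo `π` to an
element of `O_{F_v}` (residue degree one). -/
theorem exists_dvd_sub_algebraMap_of_not_irreducible
    (hfin : Module.finrank (adicCompletion K v) (adicCompletion L w) = 2)
    {ϖ : (adicCompletionIntegers K v)} (hϖ : Irreducible ϖ) {π : (adicCompletionIntegers L w)} (hπ : Irreducible π)
    (hram : ¬ Irreducible (algebraMap (adicCompletionIntegers K v) (adicCompletionIntegers L w) ϖ)) (s : (adicCompletionIntegers L w)) :
    ∃ a : (adicCompletionIntegers K v), π ∣ s - algebraMap (adicCompletionIntegers K v) (adicCompletionIntegers L w) a := by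
  obtain ⟨u, hu⟩ := exists_unit_algebraMap_eq_mul_sq v w hfin hϖ hπ hram
  exact exists_dvd_sub_algebraMap_of_inertiaDeg'_eq_one hϖ hπ
    (by rw [hu]; exact Units.dvd_mul_left.2 (dvd_pow_self π two_ne_zero))
    (inertiaDeg'_eq_one_of_not_irreducible v w hfin hϖ hπ hram) s

/-- Lemma N5.L4(iv-b) on the concrete pair at a RAMIFIED quadratic place: for every `k` a
character of `O_{E_v}ˣ` trivial on `U_E^{2k+2}` and on the image of `O_{F_v}ˣ`, non-trivial on
`U_E^{2k+1}` («conjugate-orthogonal characters of every even exact conductor exist»). -/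
theorem exists_character_exact_even_level_of_quadratic_ramified
    (hfin : Module.finrank (adicCompletion K v) (adicCompletion L w) = 2)
    {ϖ : (adicCompletionIntegers K v)} (hϖ : Irreducible ϖ) {π : (adicCompletionIntegers L w)} (hπ : Irreducible π)
    (hram : ¬ Irreducible (algebraMap (adicCompletionIntegers K v) (adicCompletionIntegers L w) ϖ)) (k : ℕ) :
    ∃ χ : (adicCompletionIntegers L w)ˣ →* ℂˣ, (∀ y ∈ higherUnits π (2 * k + 2), χ y = 1) ∧
      (∀ r : (adicCompletionIntegers K v)ˣ, χ (unitsMap r) = 1) ∧ ∃ y ∈ higherUnits π (2 * k + 1), χ y ≠ 1 := by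
  obtain ⟨u, hu⟩ := exists_unit_algebraMap_eq_mul_sq v w hfin hϖ hπ hram
  exact T5RamifiedUnitFiltration.exists_character_exact_even_level hϖ hπ hu k

/-- The parenthetical of Lemma N5.L4(iv-b) on the concrete pair: at a ramified quadratic place a
homomorphism of `O_{E_v}ˣ` trivial on `U_E^{2k+1}` and on the image of `O_{F_v}ˣ` is trivial on
`U_E^{2k}` («no conjugate-orthogonal character of odd conductor»). -/
theorem eq_one_of_mem_higherUnits_two_mul_of_quadratic_ramified {M : Type*} [Monoid M]
    (hfin : Module.finrank (adicCompletion K v) (adicCompletion L w) = 2)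
    {ϖ : (adicCompletionIntegers K v)} (hϖ : Irreducible ϖ) {π : (adicCompletionIntegers L w)} (hπ : Irreducible π)
    (hram : ¬ Irreducible (algebraMap (adicCompletionIntegers K v) (adicCompletionIntegers L w) ϖ)) (k : ℕ) (χ : (adicCompletionIntegers L w)ˣ →* M)
    (h1 : ∀ y ∈ higherUnits π (2 * k + 1), χ y = 1) (h2 : ∀ r : (adicCompletionIntegers K v)ˣ, χ (unitsMap r) = 1) :
    ∀ y ∈ higherUnits π (2 * k), χ y = 1 := by
  obtain ⟨u, hu⟩ := exists_unit_algebraMap_eq_mul_sq v w hfin hϖ hπ hram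
  exact T5RamifiedUnitFiltration.eq_one_of_mem_higherUnits_two_mul hϖ hπ hu
    (exists_dvd_sub_algebraMap_of_not_irreducible v w hfin hϖ hπ hram) k χ h1 h2

/-- Lemma N5.L4(iv-b) at the level of `E_v^× = Lwˣ`, on the concrete pair: for `F ≤ Lwˣ` with
`F ∩ O_{E_v}ˣ ⊆ image(O_{F_v}ˣ)` («`F_v^× ∩ U_E = U_F`») and every `k`, a character of `Lwˣ`
trivial on `F` and on `U_E^{2k+2}`, non-trivial on `U_E^{2k+1}`. -/
theorem exists_character_trivial_on_exact_even_level_of_quadratic_ramified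
    (hfin : Module.finrank (adicCompletion K v) (adicCompletion L w) = 2)
    {ϖ : (adicCompletionIntegers K v)} (hϖ : Irreducible ϖ) {π : (adicCompletionIntegers L w)} (hπ : Irreducible π)
    (hram : ¬ Irreducible (algebraMap (adicCompletionIntegers K v) (adicCompletionIntegers L w) ϖ)) (F : Subgroup (adicCompletion L w)ˣ)
    (hF : ∀ s : (adicCompletionIntegers L w)ˣ, Units.map (algebraMap (adicCompletionIntegers L w) (adicCompletion L w) : (adicCompletionIntegers L w) →* adicCompletion L w) s ∈ F →
      ∃ r : (adicCompletionIntegers K v)ˣ, s = unitsMap r) (k : ℕ) :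
    ∃ χ' : (adicCompletion L w)ˣ →* ℂˣ, (∀ f ∈ F, χ' f = 1) ∧
      (∀ y ∈ higherUnits π (2 * k + 2),
        χ' (Units.map (algebraMap (adicCompletionIntegers L w) (adicCompletion L w) : (adicCompletionIntegers L w) →* adicCompletion L w) y) = 1) ∧
      ∃ y ∈ higherUnits π (2 * k + 1),
        χ' (Units.map (algebraMap (adicCompletionIntegers L w) (adicCompletion L w) : (adicCompletionIntegers L w) →* adicCompletion L w) y) ≠ 1 := by
  obtain ⟨u, hu⟩ := exists_unit_algebraMap_eq_mul_sq v w hfin hϖ hπ hram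
  exact T5RamifiedCharacterInflation.exists_character_trivial_on_exact_even_level hϖ hπ hu F hF k

/-- Lemma N5.L4(iv-a) on the concrete pair at a ramified quadratic place: a character `η` of
`F ≤ Lwˣ` («`F_v^×`», `F ∩ O_{E_v}ˣ ⊆ image(O_{F_v}ˣ)`) trivial on the base units of level
`t + 1` extends to a character of `Lwˣ` trivial on `U_E^{2t+1}` («`ω̃|_{F_v^×} = η_v`,
`ω̃` trivial on `U_E^{2t+1}`»). -/
theorem exists_extension_trivial_on_higherUnits_odd_of_quadratic_ramified {Q : Type*}
    [CommGroup Q] [RootableBy Q ℤ]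
    (hfin : Module.finrank (adicCompletion K v) (adicCompletion L w) = 2)
    {ϖ : (adicCompletionIntegers K v)} (hϖ : Irreducible ϖ) {π : (adicCompletionIntegers L w)} (hπ : Irreducible π)
    (hram : ¬ Irreducible (algebraMap (adicCompletionIntegers K v) (adicCompletionIntegers L w) ϖ)) (F : Subgroup (adicCompletion L w)ˣ)
    (hF : ∀ s : (adicCompletionIntegers L w)ˣ, Units.map (algebraMap (adicCompletionIntegers L w) (adicCompletion L w) : (adicCompletionIntegers L w) →* adicCompletion L w) s ∈ F →
      ∃ r : (adicCompletionIntegers K v)ˣ, s = unitsMap r)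
    (η : F →* Q) (t : ℕ)
    (hη : ∀ (r : (adicCompletionIntegers K v)ˣ)
      (h : Units.map (algebraMap (adicCompletionIntegers L w) (adicCompletion L w) : (adicCompletionIntegers L w) →* adicCompletion L w) (unitsMap r) ∈ F),
      r ∈ higherUnits ϖ (t + 1) → η ⟨_, h⟩ = 1) :
    ∃ ω : (adicCompletion L w)ˣ →* Q, (∀ f : F, ω f = η f) ∧
      ∀ y ∈ higherUnits π (2 * t + 1),
        ω (Units.map (algebraMap (adicCompletionIntegers L w) (adicCompletion L w) : (adicCompletionIntegers L w) →* adicCompletion L w) y) = 1 := by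
  obtain ⟨u, hu⟩ := exists_unit_algebraMap_eq_mul_sq v w hfin hϖ hπ hram
  exact T5RamifiedCharacterInflation.exists_extension_trivial_on_higherUnits_odd hϖ hπ hu F hF η t hη

end Concrete

end Summit.Ventures.HodgeRepro2.T5AdicCompletionRamified
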